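import Literature.Analysis.FluidPDE.ElgindiLocalPartCoercivity
import Literature.Analysis.FluidPDE.ElgindiRadialCoefficients
import HarnessLib

/-!
# The commutators `[D_θ^iD_z^j, 𝓛₀]` of the local part of Elgindi's operator
([Elgindi2021] §6.3 / [ElgindiGhoulMasmoudi2021] §3.1)

Topic `Literature/Analysis/FluidPDE`. Proof file (everything proved, no definitions, no named
facts) on the proof path of the named fact
`Literature.Analysis.FluidPDE.Elgindi.ElgindiGhoulMasmoudi2021_stabilityCore`
(`ElgindiStabilityDecomposition.lean`). T. M. Elgindi, Ann. of Math. 194 (2021) =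
arXiv:1904.04795, §6.3 proof of Proposition 6.13 ("`D_z(𝓛_Γ^T(f)) = 𝓛_Γ^T(D_zf) + E₂` …
Observe that the derivative term comes from the commutator with the angular transport term and
`D_z`"), and Elgindi–Ghoul–Masmoudi 2021, arXiv:1910.14071, §3.1 proof of Proposition 3.2 ("This
is because `D_y` commutes with the derivative term in `𝓛` and its commutator with the other terms
is lower order … The first part of the second term comes when one `D_y` hits the factor `3/(1+y)`
and the second part of the second term comes when more than one derivative hits that factor").

For the local part `𝓛₀f = f + D_zf − (2/(1+z))f − (3/(1+z))D_θf` (`opLT0`) and a sufficiently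
smooth `f` on the open strip, this file proves the exact commutator formula
`D_θ^iD_z^j(𝓛₀f) = 𝓛₀(D_θ^iD_z^jf) − Σ_{l=1}^{j} C(j,l)[D_z^l(2/(1+z))·D_θ^iD_z^{j−l}f +
D_z^l(3/(1+z))·D_θ^{i+1}D_z^{j−l}f]` on the open strip (`iterate_Dθ_Dz_opLT0`), together with the
Leibniz formulas for radial multipliers that are smooth on `z > 0` only (`iterate_Dθ_Dz_radialMul_Ioi`,
`iterate_Dz₁_mul_Ioi`) and the commutation of the iterates (`Dz_iterate_Dθ`, `iterate_Dθ_opLT0`).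
-/

noncomputable section

open MeasureTheory Set Function Real Filter Finset
open _root_.Topology

namespace Literature.Analysis.FluidPDE

namespace Elgindi

/-! ### Radial multipliers smooth on `z > 0` -/

/-- A radial multiplier `c ∈ C^n(0, ∞)` keeps `C^n(strip)`. [folklore] -/
theorem contDiffOn_radialMul_Ioi {c : ℝ → ℝ} {f : ℝ → ℝ → ℝ} {n : WithTop ℕ∞} (hc : ContDiffOn ℝ n c (Ioi 0))
    (hf : ContDiffOn ℝ n (uncurry f) strip) : ContDiffOn ℝ n (uncurry (radialMul c f)) strip := by
  have h := (hc.comp contDiffOn_fst fun p (hp : p ∈ strip) => hp.1).mul hf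
  exact h.congr fun p _ => rfl

/-- `Dz₁` maps `C^{n+1}(0,∞)` to `C^n(0,∞)`. [folklore] -/
theorem contDiffOn_Dz₁_Ioi {c : ℝ → ℝ} {n : WithTop ℕ∞} (hc : ContDiffOn ℝ (n + 1) c (Ioi 0)) :
    ContDiffOn ℝ n (Dz₁ c) (Ioi 0) := by
  have h := contDiffOn_id.mul (hc.deriv_of_isOpen isOpen_Ioi le_rfl)
  exact h.congr fun z _ => rfl

/-- Iterates: `c ∈ C^N(0,∞)` has `Dz₁^l c ∈ C^m(0,∞)` for `l + m ≤ N`. [folklore] -/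
theorem contDiffOn_iterate_Dz₁_Ioi {c : ℝ → ℝ} {N : ℕ} (hc : ContDiffOn ℝ N c (Ioi 0)) {l m : ℕ} (h : l + m ≤ N) :
    ContDiffOn ℝ m (Dz₁^[l] c) (Ioi 0) := by
  induction l generalizing m with
  | zero => exact hc.of_le (by exact_mod_cast (by omega : m ≤ N))
  | succ l ih =>
    rw [Function.iterate_succ_apply']
    have h1 : ContDiffOn ℝ ((m + 1 : ℕ) : WithTop ℕ∞) (Dz₁^[l] c) (Ioi 0) := ih (by omega)
    exact contDiffOn_Dz₁_Ioi (by exact_mod_cast h1)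

/-- **The binomial Leibniz formula for `D_z^j(cf)` on the strip, `c ∈ C^N(0,∞)`**. [folklore] -/
theorem iterate_Dz_radialMul_Ioi {c : ℝ → ℝ} {f : ℝ → ℝ → ℝ} {N : ℕ} (hc : ContDiffOn ℝ N c (Ioi 0))
    (hf : ContDiffOn ℝ N (uncurry f) strip) {j : ℕ} (hj : j ≤ N) :
    ∀ p ∈ strip, Dz^[j] (radialMul c f) p.1 p.2 =
      ∑ l ∈ range (j + 1), (j.choose l : ℝ) * (Dz₁^[l] c p.1 * Dz^[j - l] f p.1 p.2) := by
  induction j with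
  | zero => intro p _; simp
  | succ j ih =>
    intro p hp
    have ih' := ih (by omega)
    set G : ℝ → ℝ → ℝ := fun z θ =>
      ∑ l ∈ range (j + 1), (j.choose l : ℝ) * (Dz₁^[l] c z * Dz^[j - l] f z θ) with hG
    have eG : ∀ q ∈ strip, Dz^[j] (radialMul c f) q.1 q.2 = G q.1 q.2 := fun q hq => ih' q hq
    rw [Function.iterate_succ_apply', Dz_congr eG hp]
    have hterm : ∀ l ∈ range (j + 1),
        HasDerivAt (fun z' => (j.choose l : ℝ) * (Dz₁^[l] c z' * Dz^[j - l] f z' p.2))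
          ((j.choose l : ℝ) * (deriv (Dz₁^[l] c) p.1 * Dz^[j - l] f p.1 p.2 +
            Dz₁^[l] c p.1 * dz (Dz^[j - l] f) p.1 p.2)) p.1 := by
      intro l hl
      have hl' : l ≤ j := Nat.lt_succ_iff.mp (mem_range.mp hl)
      have hcl : ContDiffOn ℝ 1 (Dz₁^[l] c) (Ioi 0) := contDiffOn_iterate_Dz₁_Ioi hc (by omega)
      have hcd : HasDerivAt (Dz₁^[l] c) (deriv (Dz₁^[l] c) p.1) p.1 :=
        ((hcl.differentiableOn (by simp)).differentiableAt (isOpen_Ioi.mem_nhds hp.1)).hasDerivAt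
      have hfl : ContDiffOn ℝ 1 (uncurry (Dz^[j - l] f)) strip := contDiffOn_iterate_Dz hf (by omega)
      have hfd : HasDerivAt (fun z' => Dz^[j - l] f z' p.2) (dz (Dz^[j - l] f) p.1 p.2) p.1 := by
        have := hasDerivAt_slice_fst (differentiableAt_of_contDiffOn_strip hfl one_ne_zero hp)
        rwa [← dz_eq_fderiv (differentiableAt_of_contDiffOn_strip hfl one_ne_zero hp)] at this
      exact (hcd.mul hfd).const_mul _
    have hsum : HasDerivAt (fun z' => G z' p.2)
        (∑ l ∈ range (j + 1), (j.choose l : ℝ) * (deriv (Dz₁^[l] c) p.1 * Dz^[j - l] f p.1 p.2 +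
            Dz₁^[l] c p.1 * dz (Dz^[j - l] f) p.1 p.2)) p.1 := by
      have := HasDerivAt.sum hterm
      refine this.congr_of_eventuallyEq (Eventually.of_forall fun z' => ?_)
      simp [hG, Finset.sum_apply]
    rw [Dz_eq_mul_dz, dz, hsum.deriv]
    simp only [Finset.mul_sum]
    have key : ∀ l ∈ range (j + 1),
        p.1 * ((j.choose l : ℝ) * (deriv (Dz₁^[l] c) p.1 * Dz^[j - l] f p.1 p.2 +
          Dz₁^[l] c p.1 * dz (Dz^[j - l] f) p.1 p.2)) =
        (j.choose l : ℝ) * (Dz₁^[l + 1] c p.1 * Dz^[j - l] f p.1 p.2) +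
          (j.choose l : ℝ) * (Dz₁^[l] c p.1 * Dz^[j + 1 - l] f p.1 p.2) := by
      intro l hl
      have hl' : l ≤ j := Nat.lt_succ_iff.mp (mem_range.mp hl)
      have e : j + 1 - l = (j - l) + 1 := by omega
      rw [e, Function.iterate_succ_apply', Function.iterate_succ_apply', Dz₁_apply, Dz_eq_mul_dz]
      ring
    rw [Finset.sum_congr rfl key, Finset.sum_add_distrib]
    rw [Finset.sum_choose_succ_mul (fun l m => Dz₁^[l] c p.1 * Dz^[m] f p.1 p.2) j, add_comm]

/-- **The Leibniz formula for the mixed iterates of a radial product on the strip, `c ∈ C^N(0,∞)`**: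
`D_θ^iD_z^j(cf) = Σ_{l ≤ j} C(j,l)(Dz₁^lc)·D_θ^iD_z^{j−l}f`, `i + j ≤ N`. [folklore] -/
theorem iterate_Dθ_Dz_radialMul_Ioi {c : ℝ → ℝ} {f : ℝ → ℝ → ℝ} {N : ℕ} (hc : ContDiffOn ℝ N c (Ioi 0))
    (hf : ContDiffOn ℝ N (uncurry f) strip) {i j : ℕ} (h : i + j ≤ N) :
    ∀ p ∈ strip, Dθ^[i] (Dz^[j] (radialMul c f)) p.1 p.2 =
      ∑ l ∈ range (j + 1), (j.choose l : ℝ) * (Dz₁^[l] c p.1 * Dθ^[i] (Dz^[j - l] f) p.1 p.2) := by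
  intro p hp
  set G : ℕ → ℝ → ℝ → ℝ := fun l =>
    radialMul (fun z => (j.choose l : ℝ) * Dz₁^[l] c z) (Dz^[j - l] f) with hG
  have eG : ∀ q ∈ strip, Dz^[j] (radialMul c f) q.1 q.2 = (∑ l ∈ range (j + 1), G l) q.1 q.2 := by
    intro q hq
    rw [iterate_Dz_radialMul_Ioi hc hf (by omega) q hq]
    simp [hG, Finset.sum_apply, mul_assoc]
  have hGl : ∀ l ∈ range (j + 1), ContDiffOn ℝ (i : ℕ) (uncurry (G l)) strip := by
    intro l hl
    have hl' : l ≤ j := Nat.lt_succ_iff.mp (mem_range.mp hl)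
    have hcl : ContDiffOn ℝ (i : ℕ) (fun z => (j.choose l : ℝ) * Dz₁^[l] c z) (Ioi 0) :=
      contDiffOn_const.mul (contDiffOn_iterate_Dz₁_Ioi hc (by omega))
    exact contDiffOn_radialMul_Ioi hcl (contDiffOn_iterate_Dz hf (by omega))
  rw [iterate_Dθ_congr eG i p hp, iterate_Dθ_finset_sum _ hGl le_rfl p hp]
  refine Finset.sum_congr rfl fun l _ => ?_
  rw [hG, iterate_Dθ_radialMul]
  simp [mul_assoc]

/-- **One-variable Leibniz on `(0, ∞)`**: `Dz₁^j(RL) = Σ_{l ≤ j} C(j,l)(Dz₁^lR)(Dz₁^{j−l}L)` for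
`R, L ∈ C^N(0,∞)`, `j ≤ N`. [folklore] -/
theorem iterate_Dz₁_mul_Ioi {R L : ℝ → ℝ} {N : ℕ} (hR : ContDiffOn ℝ N R (Ioi 0)) (hL : ContDiffOn ℝ N L (Ioi 0))
    {j : ℕ} (hj : j ≤ N) : ∀ z ∈ Ioi (0 : ℝ),
      Dz₁^[j] (fun z => R z * L z) z = ∑ l ∈ range (j + 1), (j.choose l : ℝ) * (Dz₁^[l] R z * Dz₁^[j - l] L z) := by
  intro z hz
  -- view `L` as a function on the strip independent of `θ`
  have hp : ((z, π / 4) : ℝ × ℝ) ∈ strip := ⟨hz, ⟨by positivity, by linarith [Real.pi_pos]⟩⟩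
  have hLf : ContDiffOn ℝ N (uncurry (tensor L fun _ => (1 : ℝ))) strip := by
    have h : ContDiffOn ℝ N (fun p : ℝ × ℝ => L p.1 * (1 : ℝ)) strip :=
      (hL.comp contDiffOn_fst fun p (hp : p ∈ strip) => hp.1).mul contDiffOn_const
    exact h.congr fun p _ => rfl
  have h := iterate_Dz_radialMul_Ioi hR hLf hj (z, π / 4) hp
  have e : radialMul R (tensor L fun _ => (1 : ℝ)) = tensor (fun z => R z * L z) fun _ => (1 : ℝ) := by
    funext z' θ'
    simp only [radialMul_apply, tensor]
    ring
  rw [e, iterate_Dz_tensor] at h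
  simp only [tensor, mul_one, iterate_Dz_tensor] at h
  simpa [tensor] using h

/-! ### Commuting the iterates on the strip -/

/-- `D_z` passes through `D_θ^i` on the strip: `D_z(D_θ^ig) = D_θ^i(D_zg)` for `g ∈ C^N(strip)`,
`i + 2 ≤ N`. [folklore] -/
theorem Dz_iterate_Dθ {g : ℝ → ℝ → ℝ} {N : ℕ} (hg : ContDiffOn ℝ N (uncurry g) strip) {i : ℕ}
    (h : i + 2 ≤ N) : ∀ p ∈ strip, Dz (Dθ^[i] g) p.1 p.2 = Dθ^[i] (Dz g) p.1 p.2 := by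
  induction i with
  | zero => intro p _; rfl
  | succ i ih =>
    intro p hp
    have ih' := ih (by omega)
    have hgi : ContDiffOn ℝ 2 (uncurry (Dθ^[i] g)) strip := contDiffOn_iterate_Dθ hg (m := 2) (by omega)
    rw [Function.iterate_succ_apply', Function.iterate_succ_apply', ← Dθ_Dz_comm hgi hp]
    exact Dθ_congr ih' hp

/-- `D_z^j(D_θg) = D_θ(D_z^jg)` on the strip for `g ∈ C^N(strip)`, `j + 2 ≤ N`. [folklore] -/
theorem iterate_Dz_Dθ {g : ℝ → ℝ → ℝ} {N : ℕ} (hg : ContDiffOn ℝ N (uncurry g) strip) {j : ℕ}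
    (h : j + 2 ≤ N) : ∀ p ∈ strip, Dz^[j] (Dθ g) p.1 p.2 = Dθ (Dz^[j] g) p.1 p.2 := by
  induction j with
  | zero => intro p _; rfl
  | succ j ih =>
    intro p hp
    have ih' := ih (by omega)
    have hgj : ContDiffOn ℝ 2 (uncurry (Dz^[j] g)) strip := contDiffOn_iterate_Dz hg (m := 2) (by omega)
    rw [Function.iterate_succ_apply', Function.iterate_succ_apply', Dz_congr ih' hp]
    exact (Dθ_Dz_comm hgj hp).symm

/-- `D_θ^iD_z^j(D_θf) = D_θ^{i+1}D_z^jf` on the strip, `i + j + 2 ≤ N`. [folklore] -/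
theorem iterate_Dθ_Dz_Dθ {f : ℝ → ℝ → ℝ} {N : ℕ} (hf : ContDiffOn ℝ N (uncurry f) strip) {i j : ℕ}
    (h : i + j + 2 ≤ N) : ∀ p ∈ strip, Dθ^[i] (Dz^[j] (Dθ f)) p.1 p.2 = Dθ^[i + 1] (Dz^[j] f) p.1 p.2 := by
  intro p hp
  rw [iterate_Dθ_congr (iterate_Dz_Dθ hf (by omega)) i p hp, Function.iterate_succ_apply]

/-- `D_θ^i𝓛₀ = 𝓛₀D_θ^i` on the strip, `i + 2 ≤ N`. [cite: Elgindi2021, §6.3 proof of Proposition 6.13 (p. 18 of arXiv:1904.04795)] -/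
theorem iterate_Dθ_opLT0 {f : ℝ → ℝ → ℝ} {N : ℕ} (hf : ContDiffOn ℝ N (uncurry f) strip) {i : ℕ}
    (h : i + 2 ≤ N) : ∀ p ∈ strip, Dθ^[i] (opLT0 f) p.1 p.2 = opLT0 (Dθ^[i] f) p.1 p.2 := by
  induction i with
  | zero => intro p _; rfl
  | succ i ih =>
    intro p hp
    have ih' := ih (by omega)
    have hfi : ContDiffOn ℝ 2 (uncurry (Dθ^[i] f)) strip := contDiffOn_iterate_Dθ hf (m := 2) (by omega)
    rw [Function.iterate_succ_apply', Function.iterate_succ_apply', Dθ_congr ih' hp]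
    exact Dθ_opLT0 hfi hp

/-! ### `𝓛₀` as a combination of radial multipliers -/

/-- `𝓛₀f = f + D_zf − (2/(1+z))·f − (3/(1+z))·D_θf` as functions. [folklore] -/
theorem opLT0_eq (f : ℝ → ℝ → ℝ) :
    opLT0 f = f + Dz f - radialMul (fun z => 2 / (1 + z)) f - radialMul (fun z => 3 / (1 + z)) (Dθ f) := by
  funext z θ
  simp only [opLT0_apply, opL_apply, Pi.add_apply, Pi.sub_apply, radialMul_apply]
  ring

/-- Regularity of `𝓛₀f` on the strip: `C^{n}` for `f ∈ C^{n+1}`. [folklore] -/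
theorem contDiffOn_opLT0 {f : ℝ → ℝ → ℝ} {n : ℕ} (hf : ContDiffOn ℝ (n + 1) (uncurry f) strip) :
    ContDiffOn ℝ n (uncurry (opLT0 f)) strip := by
  have hc : ∀ a : ℝ, ContDiffOn ℝ n (fun z : ℝ => a / (1 + z)) (Ioi 0) := fun a =>
    contDiffOn_const.div (by fun_prop) fun z hz => by have : (0 : ℝ) < z := hz; positivity
  have h0 : ContDiffOn ℝ n (uncurry f) strip := hf.of_le (by exact_mod_cast Nat.le_succ n)
  have h1 : ContDiffOn ℝ n (uncurry (Dz f)) strip := contDiffOn_Dz (by exact_mod_cast hf)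
  have h2 : ContDiffOn ℝ n (uncurry (Dθ f)) strip := contDiffOn_Dθ (by exact_mod_cast hf)
  rw [opLT0_eq]
  have h := ((h0.add h1).sub (contDiffOn_radialMul_Ioi (hc 2) h0)).sub (contDiffOn_radialMul_Ioi (hc 3) h2)
  exact h.congr fun p _ => by simp [Function.uncurry]

/-! ### The commutator formula -/

/-- **`[D_θ^iD_z^j, 𝓛₀]` on the strip**: for `f ∈ C^N(strip)`, `i + j + 3 ≤ N`,
`D_θ^iD_z^j(𝓛₀f) = 𝓛₀(D_θ^iD_z^jf) − Σ_{l<j} C(j,l+1)[Dz₁^{l+1}(2/(1+z))·D_θ^iD_z^{j−(l+1)}f +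
Dz₁^{l+1}(3/(1+z))·D_θ^{i+1}D_z^{j−(l+1)}f]`: `D_θ^iD_z^j` commutes with `1 + D_z`, and produces lower
`z`-order or `θ`-heavier terms from the two `1/(1+z)`-coefficients. [cite: Elgindi2021, §6.3 proof of Proposition 6.13 (p. 18 of arXiv:1904.04795); ElgindiGhoulMasmoudi2021, §3.1 proof of Proposition 3.2 (p. 10 of arXiv:1910.14071)] -/
theorem iterate_Dθ_Dz_opLT0 {f : ℝ → ℝ → ℝ} {N : ℕ} (hf : ContDiffOn ℝ N (uncurry f) strip) {i j : ℕ}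
    (h : i + j + 3 ≤ N) : ∀ p ∈ strip,
    Dθ^[i] (Dz^[j] (opLT0 f)) p.1 p.2 = opLT0 (Dθ^[i] (Dz^[j] f)) p.1 p.2
      - ∑ l ∈ range j, (j.choose (l + 1) : ℝ) *
          (Dz₁^[l + 1] (fun z : ℝ => 2 / (1 + z)) p.1 * Dθ^[i] (Dz^[j - (l + 1)] f) p.1 p.2 +
            Dz₁^[l + 1] (fun z : ℝ => 3 / (1 + z)) p.1 * Dθ^[i + 1] (Dz^[j - (l + 1)] f) p.1 p.2) := by
  intro p hp
  have hc : ∀ a : ℝ, ContDiffOn ℝ N (fun z : ℝ => a / (1 + z)) (Ioi 0) := fun a =>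
    contDiffOn_const.div (by fun_prop) fun z hz => by have : (0 : ℝ) < z := hz; positivity
  have hN1 : ContDiffOn ℝ ((N - 1 : ℕ) : WithTop ℕ∞) (uncurry f) strip := hf.of_le (by exact_mod_cast Nat.sub_le N 1)
  have hfN : ContDiffOn ℝ (((N - 1 : ℕ) : WithTop ℕ∞) + 1) (uncurry f) strip :=
    hf.of_le (by exact_mod_cast (by omega : N - 1 + 1 ≤ N))
  have hDz : ContDiffOn ℝ ((N - 1 : ℕ) : WithTop ℕ∞) (uncurry (Dz f)) strip := contDiffOn_Dz hfN
  have hDθ : ContDiffOn ℝ ((N - 1 : ℕ) : WithTop ℕ∞) (uncurry (Dθ f)) strip := contDiffOn_Dθ hfN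
  have hM₁ : ContDiffOn ℝ ((N - 1 : ℕ) : WithTop ℕ∞) (uncurry (radialMul (fun z : ℝ => 2 / (1 + z)) f)) strip :=
    contDiffOn_radialMul_Ioi ((hc 2).of_le (by exact_mod_cast Nat.sub_le N 1)) hN1
  have hM₂ : ContDiffOn ℝ ((N - 1 : ℕ) : WithTop ℕ∞) (uncurry (radialMul (fun z : ℝ => 3 / (1 + z)) (Dθ f))) strip :=
    contDiffOn_radialMul_Ioi ((hc 3).of_le (by exact_mod_cast Nat.sub_le N 1)) hDθ
  -- expand `D_θ^i D_z^j (𝓛₀ f)` along `𝓛₀ f = ((f + D_z f) − m₁f) − m₂D_θf`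
  have hij : i + j ≤ N - 1 := by omega
  have e0 : Dθ^[i] (Dz^[j] (opLT0 f)) p.1 p.2 =
      Dθ^[i] (Dz^[j] f) p.1 p.2 + Dθ^[i] (Dz^[j] (Dz f)) p.1 p.2
        - Dθ^[i] (Dz^[j] (radialMul (fun z : ℝ => 2 / (1 + z)) f)) p.1 p.2
        - Dθ^[i] (Dz^[j] (radialMul (fun z : ℝ => 3 / (1 + z)) (Dθ f))) p.1 p.2 := by
    rw [opLT0_eq, iterate_Dθ_Dz_sub ((hN1.add hDz).sub hM₁) hM₂ hij p hp,
      iterate_Dθ_Dz_sub (hN1.add hDz) hM₁ hij p hp, iterate_Dθ_Dz_add hN1 hDz hij p hp]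
  -- the four pieces
  have e1 : Dθ^[i] (Dz^[j] (Dz f)) p.1 p.2 = Dθ^[i] (Dz^[j + 1] f) p.1 p.2 := by
    rw [← Function.iterate_succ_apply Dz j f]
  have e2 := iterate_Dθ_Dz_radialMul_Ioi ((hc 2).of_le (by exact_mod_cast Nat.sub_le N 1)) hN1 hij p hp
  have e3 := iterate_Dθ_Dz_radialMul_Ioi ((hc 3).of_le (by exact_mod_cast Nat.sub_le N 1)) hDθ hij p hp
  -- in `e3`, `D_θ^i D_z^{j-l} (D_θ f) = D_θ^{i+1} D_z^{j-l} f`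
  have e3' : ∀ l ∈ range (j + 1), (j.choose l : ℝ) * (Dz₁^[l] (fun z : ℝ => 3 / (1 + z)) p.1 *
      Dθ^[i] (Dz^[j - l] (Dθ f)) p.1 p.2) =
      (j.choose l : ℝ) * (Dz₁^[l] (fun z : ℝ => 3 / (1 + z)) p.1 * Dθ^[i + 1] (Dz^[j - l] f) p.1 p.2) := by
    intro l hl
    rw [iterate_Dθ_Dz_Dθ hf (by omega) p hp]
  rw [Finset.sum_congr rfl e3'] at e3
  -- `𝓛₀ (D_θ^i D_z^j f)` at `p`
  have hg : ContDiffOn ℝ 3 (uncurry (Dθ^[i] (Dz^[j] f))) strip := contDiffOn_iterate_Dθ_Dz hf (m := 3) (by omega)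
  have e4 : opLT0 (Dθ^[i] (Dz^[j] f)) p.1 p.2 = Dθ^[i] (Dz^[j] f) p.1 p.2 + Dθ^[i] (Dz^[j + 1] f) p.1 p.2
      - 2 / (1 + p.1) * Dθ^[i] (Dz^[j] f) p.1 p.2 - 3 / (1 + p.1) * Dθ^[i + 1] (Dz^[j] f) p.1 p.2 := by
    rw [opLT0_eq]
    simp only [Pi.add_apply, Pi.sub_apply, radialMul_apply]
    have hz : Dz (Dθ^[i] (Dz^[j] f)) p.1 p.2 = Dθ^[i] (Dz^[j + 1] f) p.1 p.2 := by
      rw [Dz_iterate_Dθ (contDiffOn_iterate_Dz hf (by omega : j + (i + 2) ≤ N)) le_rfl p hp,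
        ← Function.iterate_succ_apply' Dz j f]
    have hθ : Dθ (Dθ^[i] (Dz^[j] f)) p.1 p.2 = Dθ^[i + 1] (Dz^[j] f) p.1 p.2 := by
      rw [← Function.iterate_succ_apply' Dθ i]
    rw [hz, hθ]
  -- split off the `l = 0` terms of the two Leibniz sums
  rw [e0, e1, e2, e3, e4, Finset.sum_range_succ', Finset.sum_range_succ']
  simp only [Nat.choose_zero_right, Nat.cast_one, one_mul, Function.iterate_zero_apply, Nat.sub_zero, mul_add]
  rw [Finset.sum_add_distrib]
  ring

end Elgindi

end Literature.Analysis.FluidPDE
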